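import Mathlib
import HarnessLib
import Literature.MathematicalPhysics.QuantumLattice.KohnLuttinger
import Literature.MathematicalPhysics.QuantumLattice.KohnLuttingerLindhardMeasurable
import Literature.MathematicalPhysics.QuantumLattice.KohnLuttingerChannelStates
import Summits.HubbardSuperconductivity.HubbardSuperconductivity.Theorems.WeakCouplingBCSWcbcsKohnLuttingerB1gReduction
import Summits.HubbardSuperconductivity.HubbardSuperconductivity.Theorems.WeakCouplingBCSWcbcsKohnLuttingerB1gMuWindow
import Summits.HubbardSuperconductivity.HubbardSuperconductivity.Theorems.ChiralWindowCwKLChiralWindowD4Invariant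
import Summits.HubbardSuperconductivity.HubbardSuperconductivity.Theorems.ChiralWindowCwKLChiralWindowSectorProj
import Summits.HubbardSuperconductivity.HubbardSuperconductivity.Theorems.WeakCouplingBCSDefsKlCertTPrime
import Summits.HubbardSuperconductivity.HubbardSuperconductivity.Theorems.WeakCouplingBCSKlCertTPrimePHReflectionShift

/-!
# Route `WeakCouplingBCS` — particle–hole ⊗ `(π, π)` reflection of the Kohn–Luttinger data, II: Lindhard function,
# filling and Fermi-curve measure (located item «(KLSCAN)-TPRIME-PH-REFLECTION», stmt-HubbardSuperconductivity-0158; file 2 of 3)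

With the shift `T = klphShift` of file 1 (`…PHReflectionShift`):

* §1 every level set `{ε_{t′} = c}` of the `t`–`t′` band is Lebesgue-null (`klph_volume_levelSet`, the general-`t′` twin of
  `Literature…volume_levelSet_squareDispersion`; slices are level sets of `cos` off a countable set of abscissae);
* §2 **`lindhardFunction ε_{t′} μ q = lindhardFunction ε_{-t′} (-μ) q`** for every transfer `q` (`klph_lindhardFunction_ph`:
  substitute `p ↦ T p` on the zone; by `Literature…lindhardIntegrand_eq_ite_inv` the integrands agree off the reflected Fermi
  level, a null set), and the Kohn–Luttinger kernel identity `Γ[ε_{t′}, μ](T k, T k') = Γ[ε_{-t′}, -μ](k, k')` on the zone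
  (`klph_kohnLuttingerKernel_shift`; `χ₀` is `2πℤ²`-periodic in the transfer);
* §3 **`KohnLuttinger.filling ε_{t′} μ = 2 - KohnLuttinger.filling ε_{-t′} (-μ)`** (`klph_filling_ph`; `vol BZ = (2π)²`);
* §4 the gradient `∇ε_{t′}(k) = (2 sin k₀ (1 + 2t′ cos k₁), 2 sin k₁ (1 + 2t′ cos k₀))` (`klph_gradient_squareDispersion`),
  `∇ε_{t′}(T k) = -∇ε_{-t′}(k)` on the zone, arc length `μH[1]` of subsets of the zone is `T`-invariant (four quadrant
  translations), and **`T` pushes the Fermi-curve measure `σ[ε_{-t′}, -μ]` forward to `σ[ε_{t′}, μ]`**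
  (`klph_measurePreserving_shift_fermiCurveMeasure`).

No definitions.  References: S. Raghu, S. A. Kivelson, D. J. Scalapino, Phys. Rev. B 81 (2010) 224505, §II (4)–(8).
-/

noncomputable section

-- the tree's namespace `Summit.<Summit>.<Problem>.Theorems` repeats the summit name by design (D-0017)
set_option linter.dupNamespace false

namespace Summit.HubbardSuperconductivity.HubbardSuperconductivity.Theorems

open MeasureTheory Set Real Literature.MathematicalPhysics.QuantumLattice
open scoped ENNReal

/-! ### §1 Level sets of the `t`–`t′` dispersion are Lebesgue-null -/

/-- **Every level set `{ε_{t′} = c}` of the `t`–`t′` band is Lebesgue-null** (general-`t′` twin of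
`Literature…volume_levelSet_squareDispersion`): for all but countably many `k₀` the slice
`{k₁ | ε_{t′}(k₀, k₁) = c}` is contained in a level set of `cos`, hence countable. [folklore] -/
theorem klph_volume_levelSet (tp c : ℝ) :
    volume {p : Momentum | squareDispersion 1 tp p = c} = 0 := by
  set T : Set (ℝ × ℝ) := {x | -2 * 1 * (cos x.1 + cos x.2) - 4 * tp * cos x.1 * cos x.2 = c} with hT
  have hTmeas : MeasurableSet T := by
    refine (isClosed_eq ?_ continuous_const).measurableSet
    fun_prop
  have hpre : {p : Momentum | squareDispersion 1 tp p = c} =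
      (fun k : Momentum => ((k 0, k 1) : ℝ × ℝ)) ⁻¹' T := by
    ext p; simp [hT, squareDispersion]
  rw [hpre, measurePreserving_momentum_prod.measure_preimage hTmeas.nullMeasurableSet]
  rw [show (volume : Measure (ℝ × ℝ)) = (volume : Measure ℝ).prod volume from rfl,
    Measure.measure_prod_null hTmeas]
  have hbad : volume {x : ℝ | cos x = -1 / (2 * tp)} = 0 := (countable_setOf_cos_eq _).measure_zero volume
  filter_upwards [measure_eq_zero_iff_ae_notMem.1 hbad] with x hx
  have hA : -2 - 4 * tp * cos x ≠ 0 := by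
    intro h
    have htp : tp ≠ 0 := by rintro rfl; norm_num at h
    have hcos : cos x = -1 / (2 * tp) := by
      field_simp
      linarith
    exact hx hcos
  have hslice : Prod.mk x ⁻¹' T ⊆ {y : ℝ | cos y = (c + 2 * cos x) / (-2 - 4 * tp * cos x)} := by
    intro y hy
    simp only [hT, mem_preimage, mem_setOf_eq] at hy ⊢
    rw [eq_div_iff hA]
    linarith
  have h0 : volume (Prod.mk x ⁻¹' T) = 0 :=
    measure_mono_null hslice ((countable_setOf_cos_eq _).measure_zero volume)
  simpa using h0

/-- Translates of level sets are null too: `vol {p | ε_{t′}(p + q) = c} = 0`. [folklore] -/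
theorem klph_volume_levelSet_add (tp c : ℝ) (q : Momentum) :
    volume {p : Momentum | squareDispersion 1 tp (p + q) = c} = 0 := by
  have : {p : Momentum | squareDispersion 1 tp (p + q) = c} =
      (fun p => p + q) ⁻¹' {p : Momentum | squareDispersion 1 tp p = c} := rfl
  rw [this, measure_preimage_add_right]
  exact klph_volume_levelSet tp c


/-! ### §2 Particle–hole invariance of the Lindhard function -/

/-- The Lindhard integrand depends on the transfer `q` only through `ε (· + q)`: two transfers with
`ε (p + q') = ε (p + q)` for all `p` have the same integrand. [folklore] -/
theorem klph_lindhardIntegrand_congr_right {ε : Momentum → ℝ} (μ : ℝ) {q q' : Momentum}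
    (h : ∀ p, ε (p + q') = ε (p + q)) : lindhardIntegrand ε μ q' = lindhardIntegrand ε μ q := by
  funext p
  simp only [lindhardIntegrand, fermiOccupation, h p]

/-- … hence the same Lindhard function (periodicity of `χ₀` in the transfer is the case
`q' - q ∈ 2πℤ²`). [folklore] -/
theorem klph_lindhardFunction_congr {ε : Momentum → ℝ} (μ : ℝ) {q q' : Momentum}
    (h : ∀ p, ε (p + q') = ε (p + q)) : lindhardFunction ε μ q' = lindhardFunction ε μ q := by
  simp only [lindhardFunction, klph_lindhardIntegrand_congr_right μ h]

/-- **Pointwise particle–hole identity for the Lindhard integrand**: for `p ∈ BZ` off the reflected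
Fermi level (`ε_{-t′}(p) ≠ -μ`, `ε_{-t′}(p + q) ≠ -μ`),
`L[ε_{t′}, μ](q, T p) = L[ε_{-t′}, -μ](q, p)` — both equal `1 / (|ε_{-t′}(p) + μ| + |ε_{-t′}(p+q) + μ|)`
when exactly one of `p`, `p + q` is occupied, and `0` otherwise. [cite: RaghuKivelsonScalapino2010, §II (5)] -/
theorem klph_lindhardIntegrand_shift (tp μ : ℝ) (q : Momentum) {p : Momentum} (hp : p ∈ brillouinZone)
    (h1 : squareDispersion 1 (-tp) p ≠ -μ) (h2 : squareDispersion 1 (-tp) (p + q) ≠ -μ) :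
    lindhardIntegrand (squareDispersion 1 tp) μ q (klphShift p) =
      lindhardIntegrand (squareDispersion 1 (-tp)) (-μ) q p := by
  rw [lindhardIntegrand_eq_ite_inv, lindhardIntegrand_eq_ite_inv]
  have e1 := klph_squareDispersion_shift tp hp
  have e2 := klph_squareDispersion_shift_add tp hp q
  have key : ∀ {a : ℝ}, a ≠ -μ → ((-a < μ) ↔ ¬ (a < -μ)) := fun {a} ha =>
    ⟨fun h h' => by linarith, fun h => by
      have := lt_of_le_of_ne (not_lt.1 h) (Ne.symm ha)
      linarith⟩
  have hocc : (fermiOccupation (squareDispersion 1 tp) μ (klphShift p) =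
        fermiOccupation (squareDispersion 1 tp) μ (klphShift p + q)) ↔
      (fermiOccupation (squareDispersion 1 (-tp)) (-μ) p =
        fermiOccupation (squareDispersion 1 (-tp)) (-μ) (p + q)) := by
    simp only [fermiOccupation, e1, e2, key h1, key h2]
    by_cases ha : squareDispersion 1 (-tp) p < -μ <;>
      by_cases hb : squareDispersion 1 (-tp) (p + q) < -μ <;> simp [ha, hb]
  have habs : ∀ z : ℝ, |-z - μ| = |z - -μ| := fun z => by
    rw [show -z - μ = -(z - -μ) by ring, abs_neg]
  rw [e1, e2, habs, habs]
  split_ifs with hL hR hR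
  · rfl
  · exact absurd (hocc.1 hL) hR
  · exact absurd (hocc.2 hR) hL
  · rfl

/-- **Particle–hole ⊗ `(π, π)` invariance of the static Lindhard function of the `t`–`t′` band**:
`χ₀[ε_{t′}, μ](q) = χ₀[ε_{-t′}, -μ](q)` for every transfer `q` (substitute `p ↦ T p` on the zone; the
integrands agree off a Lebesgue-null set). [cite: RaghuKivelsonScalapino2010, §II (5)] -/
theorem klph_lindhardFunction_ph (tp μ : ℝ) (q : Momentum) :
    lindhardFunction (squareDispersion 1 tp) μ q = lindhardFunction (squareDispersion 1 (-tp)) (-μ) q := by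
  unfold lindhardFunction
  congr 1
  rw [← klph_measurePreserving_shift_restrict.integral_comp klph_measurableEmbedding_shift
    (lindhardIntegrand (squareDispersion 1 tp) μ q)]
  refine integral_congr_ae ?_
  have h0 : ∀ᵐ p ∂(volume.restrict brillouinZone), p ∈ brillouinZone :=
    ae_restrict_mem measurableSet_brillouinZone
  have h1 : ∀ᵐ p ∂(volume.restrict brillouinZone), p ∉ {p : Momentum | squareDispersion 1 (-tp) p = -μ} :=
    ae_restrict_of_ae (measure_eq_zero_iff_ae_notMem.1 (klph_volume_levelSet (-tp) (-μ)))
  have h2 : ∀ᵐ p ∂(volume.restrict brillouinZone),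
      p ∉ {p : Momentum | squareDispersion 1 (-tp) (p + q) = -μ} :=
    ae_restrict_of_ae (measure_eq_zero_iff_ae_notMem.1 (klph_volume_levelSet_add (-tp) (-μ) q))
  filter_upwards [h0, h1, h2] with p hp hp1 hp2
  exact klph_lindhardIntegrand_shift tp μ q hp hp1 hp2

/-- **The Kohn–Luttinger kernel under the shift**: for `k, k' ∈ BZ`,
`Γ[ε_{t′}, μ](T k, T k') = Γ[ε_{-t′}, -μ](k, k')` (`T k + T k' ≡ k + k'` mod `2πℤ²`, `χ₀` is periodic
in the transfer, then particle–hole invariance). [cite: RaghuKivelsonScalapino2010, §II (7)] -/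
theorem klph_kohnLuttingerKernel_shift (tp μ U : ℝ) {k k' : Momentum} (hk : k ∈ brillouinZone)
    (hk' : k' ∈ brillouinZone) :
    kohnLuttingerKernel (squareDispersion 1 tp) μ U (klphShift k) (klphShift k') =
      kohnLuttingerKernel (squareDispersion 1 (-tp)) (-μ) U k k' := by
  have hc : ∀ {x y : ℝ}, x ∈ Ico (-π) π → y ∈ Ico (-π) π → ∀ a : ℝ,
      cos (a + (klphTau x + klphTau y)) = cos (a + (x + y)) := fun {x y} hx hy a => by
    rcases klphTau_eq_add_pi_or hx with h | h <;> rcases klphTau_eq_add_pi_or hy with h' | h' <;> rw [h, h']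
    · rw [show a + (x + π + (y + π)) = a + (x + y) + 2 * π by ring, cos_add_two_pi]
    · ring_nf
    · ring_nf
    · rw [show a + (x - π + (y - π)) = a + (x + y) - 2 * π by ring, cos_sub_two_pi]
  have hper : ∀ p : Momentum, squareDispersion 1 tp (p + (klphShift k + klphShift k')) =
      squareDispersion 1 tp (p + (k + k')) := fun p => by
    simp only [squareDispersion, PiLp.add_apply, klphShift_apply_zero, klphShift_apply_one,
      hc (hk 0) (hk' 0), hc (hk 1) (hk' 1)]
  unfold kohnLuttingerKernel
  rw [klph_lindhardFunction_congr μ hper, klph_lindhardFunction_ph]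

/-! ### §3 The filling -/

/-- `vol(BZ) = (2π)²` as a real number (from `volume_brillouinZone` of `…WcbcsKohnLuttingerB1gMuWindow`).
[folklore] -/
theorem klph_volume_brillouinZone_toReal : (volume brillouinZone).toReal = (2 * π) ^ 2 := by
  rw [volume_brillouinZone, ENNReal.toReal_pow, ENNReal.toReal_ofReal (by positivity)]

/-- The Fermi occupation is integrable on the zone (bounded by `1`, finite volume). [folklore] -/
theorem klph_integrableOn_fermiOccupation (t tp μ : ℝ) :
    IntegrableOn (fermiOccupation (squareDispersion t tp) μ) brillouinZone volume := by
  refine Measure.integrableOn_of_bounded (M := 1) volume_brillouinZone_lt_top.ne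
    (measurable_fermiOccupation (measurable_squareDispersion t tp) μ).aestronglyMeasurable ?_
  refine Filter.Eventually.of_forall fun p => ?_
  unfold fermiOccupation
  split_ifs <;> simp

/-- **Particle–hole ⊗ `(π, π)` for the filling**: `n[ε_{t′}](μ) = 2 - n[ε_{-t′}](-μ)` — the hole
doping of `(t′, μ)` is the electron doping of `(-t′, -μ)`. [cite: RaghuKivelsonScalapino2010, §II (4)] -/
theorem klph_filling_ph (tp μ : ℝ) :
    KohnLuttinger.filling (squareDispersion 1 tp) μ =
      2 - KohnLuttinger.filling (squareDispersion 1 (-tp)) (-μ) := by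
  unfold KohnLuttinger.filling
  have hsub : ∫ p in brillouinZone, fermiOccupation (squareDispersion 1 tp) μ p =
      ∫ p in brillouinZone, fermiOccupation (squareDispersion 1 tp) μ (klphShift p) :=
    (klph_measurePreserving_shift_restrict.integral_comp klph_measurableEmbedding_shift _).symm
  have hae : (fun p => fermiOccupation (squareDispersion 1 tp) μ (klphShift p)) =ᵐ[volume.restrict brillouinZone]
      fun p => (1 : ℝ) - fermiOccupation (squareDispersion 1 (-tp)) (-μ) p := by
    have h0 : ∀ᵐ p ∂(volume.restrict brillouinZone), p ∈ brillouinZone :=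
      ae_restrict_mem measurableSet_brillouinZone
    have h1 : ∀ᵐ p ∂(volume.restrict brillouinZone),
        p ∉ {p : Momentum | squareDispersion 1 (-tp) p = -μ} :=
      ae_restrict_of_ae (measure_eq_zero_iff_ae_notMem.1 (klph_volume_levelSet (-tp) (-μ)))
    filter_upwards [h0, h1] with p hp hne
    simp only [fermiOccupation, klph_squareDispersion_shift tp hp]
    by_cases h : squareDispersion 1 (-tp) p < -μ
    · have h' : ¬ (-squareDispersion 1 (-tp) p < μ) := fun h' => by linarith
      simp [h, h']
    · have h' : -squareDispersion 1 (-tp) p < μ := by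
        have := lt_of_le_of_ne (not_lt.1 h) (Ne.symm hne)
        linarith
      simp [h, h']
  have hi1 : IntegrableOn (fun _ : Momentum => (1 : ℝ)) brillouinZone volume :=
    integrableOn_const volume_brillouinZone_lt_top.ne
  have hi2 := klph_integrableOn_fermiOccupation 1 (-tp) (-μ)
  rw [hsub, integral_congr_ae hae, integral_sub hi1 hi2, setIntegral_const, smul_eq_mul, mul_one,
    measureReal_def, klph_volume_brillouinZone_toReal]
  have hπ : (2 * π) ^ 2 ≠ 0 := by positivity
  field_simp

/-! ### §4 The gradient of the `t`–`t′` band and the Fermi-curve measure under the shift -/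

/-- **`∇ε_{t′}(k) = (2 sin k₀ (1 + 2t′ cos k₁), 2 sin k₁ (1 + 2t′ cos k₀))`** for the `t`–`t′` band on the
Euclidean plane (general-`t′` twin of `Literature…hasGradientAt_squareDispersion`). [folklore] -/
theorem klph_hasGradientAt_squareDispersion (s : ℝ) (k : Momentum) :
    HasGradientAt (squareDispersion 1 s)
      (WithLp.toLp 2 ![2 * sin (k 0) * (1 + 2 * s * cos (k 1)), 2 * sin (k 1) * (1 + 2 * s * cos (k 0))]) k := by
  rw [hasGradientAt_iff_hasFDerivAt]
  set P0 : Momentum →L[ℝ] ℝ := PiLp.proj 2 (fun _ : Fin 2 => ℝ) (0 : Fin 2) with hP0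
  set P1 : Momentum →L[ℝ] ℝ := PiLp.proj 2 (fun _ : Fin 2 => ℝ) (1 : Fin 2) with hP1
  have hc0 : HasDerivAt Real.cos (-Real.sin (k 0)) (P0 k) := Real.hasDerivAt_cos (k 0)
  have hc1 : HasDerivAt Real.cos (-Real.sin (k 1)) (P1 k) := Real.hasDerivAt_cos (k 1)
  have h0 : HasFDerivAt (Real.cos ∘ ⇑P0) (-Real.sin (k 0) • P0) k := hc0.comp_hasFDerivAt k P0.hasFDerivAt
  have h1 : HasFDerivAt (Real.cos ∘ ⇑P1) (-Real.sin (k 1) • P1) k := hc1.comp_hasFDerivAt k P1.hasFDerivAt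
  have h := ((h0.add h1).const_mul (-2 : ℝ)).sub ((h0.mul h1).const_mul (4 * s))
  have hfun : squareDispersion 1 s = fun q : Momentum =>
      (-2 : ℝ) * (Real.cos ∘ ⇑P0 + Real.cos ∘ ⇑P1) q - 4 * s * ((Real.cos ∘ ⇑P0) q * (Real.cos ∘ ⇑P1) q) := by
    funext q; simp [squareDispersion, hP0, hP1]; ring
  rw [hfun]
  refine h.congr_fderiv ?_
  ext q
  rw [InnerProductSpace.toDual_apply_apply]
  simp [hP0, hP1, PiLp.inner_apply, Fin.sum_univ_two]
  ring

/-- `∇ε_{t′}(k)` as a vector. [folklore] -/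
theorem klph_gradient_squareDispersion (s : ℝ) (k : Momentum) :
    gradient (squareDispersion 1 s) k =
      WithLp.toLp 2 ![2 * sin (k 0) * (1 + 2 * s * cos (k 1)), 2 * sin (k 1) * (1 + 2 * s * cos (k 0))] :=
  (klph_hasGradientAt_squareDispersion s k).gradient

/-- Under the shift the Fermi velocity flips sign: `∇ε_{t′}(T k) = -∇ε_{-t′}(k)` for `k ∈ BZ`. [folklore] -/
theorem klph_gradient_klphShift (tp : ℝ) {k : Momentum} (hk : k ∈ brillouinZone) :
    gradient (squareDispersion 1 tp) (klphShift k) = -gradient (squareDispersion 1 (-tp)) k := by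
  rw [klph_gradient_squareDispersion, klph_gradient_squareDispersion]
  ext i
  fin_cases i <;> simp [sin_klphTau (hk 0), sin_klphTau (hk 1), cos_klphTau (hk 0), cos_klphTau (hk 1)]

/-- … so the Fermi speed (and the density of states weight `‖∇ε‖⁻¹`) is shift invariant on the zone.
[folklore] -/
theorem klph_density_klphShift (tp : ℝ) {k : Momentum} (hk : k ∈ brillouinZone) :
    ENNReal.ofReal (‖gradient (squareDispersion 1 tp) (klphShift k)‖⁻¹) =
      ENNReal.ofReal (‖gradient (squareDispersion 1 (-tp)) k‖⁻¹) := by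
  rw [klph_gradient_klphShift tp hk, norm_neg]

/-- Arc length `μH[1]` on momentum space is translation invariant. [folklore] -/
theorem klph_hausdorffMeasure_image_add_right (v : Momentum) (s : Set Momentum) :
    μH[1] ((fun k => k + v) '' s) = μH[1] s :=
  (IsometryEquiv.addRight v).hausdorffMeasure_image 1 s

/-- **The shift does not increase arc length of subsets of the zone** (on each of the four quadrants of
`[-π, π)²` it is a translation by `(±π, ±π)`). [folklore] -/
theorem klph_hausdorffMeasure_image_shift_le {B : Set Momentum} (hB : B ⊆ brillouinZone) :
    μH[1] (klphShift '' B) ≤ μH[1] B := by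
  have hc0 : Measurable fun k : Momentum => k 0 := (PiLp.continuous_apply 2 (fun _ : Fin 2 => ℝ) 0).measurable
  have hc1 : Measurable fun k : Momentum => k 1 := (PiLp.continuous_apply 2 (fun _ : Fin 2 => ℝ) 1).measurable
  have hH0 : MeasurableSet {k : Momentum | k 0 < 0} := measurableSet_lt hc0 measurable_const
  have hH1 : MeasurableSet {k : Momentum | k 1 < 0} := measurableSet_lt hc1 measurable_const
  -- the four quadrant pieces and the translation on each
  have hl : ∀ {k : Momentum}, k ∈ B → ∀ i, k i < 0 → klphTau (k i) = k i + π := fun hk i hi =>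
    klphTau_of_mem_left ⟨(hB hk i).1, hi⟩
  have hr : ∀ {k : Momentum}, k ∈ B → ∀ i, ¬ k i < 0 → klphTau (k i) = k i + -π := fun hk i hi => by
    rw [klphTau_of_mem_right ⟨not_lt.1 hi, (hB hk i).2⟩, sub_eq_add_neg]
  have h1 : EqOn klphShift (fun k => k + WithLp.toLp 2 ![π, π]) ((B ∩ {k | k 0 < 0}) ∩ {k | k 1 < 0}) :=
    fun k ⟨⟨hk, h0⟩, h1⟩ => by ext i; fin_cases i <;> simp [hl hk 0 h0, hl hk 1 h1]
  have h2 : EqOn klphShift (fun k => k + WithLp.toLp 2 ![π, -π]) ((B ∩ {k | k 0 < 0}) \ {k | k 1 < 0}) :=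
    fun k ⟨⟨hk, h0⟩, h1⟩ => by ext i; fin_cases i <;> simp [hl hk 0 h0, hr hk 1 h1]
  have h3 : EqOn klphShift (fun k => k + WithLp.toLp 2 ![-π, π]) ((B \ {k | k 0 < 0}) ∩ {k | k 1 < 0}) :=
    fun k ⟨⟨hk, h0⟩, h1⟩ => by ext i; fin_cases i <;> simp [hr hk 0 h0, hl hk 1 h1]
  have h4 : EqOn klphShift (fun k => k + WithLp.toLp 2 ![-π, -π]) ((B \ {k | k 0 < 0}) \ {k | k 1 < 0}) :=
    fun k ⟨⟨hk, h0⟩, h1⟩ => by ext i; fin_cases i <;> simp [hr hk 0 h0, hr hk 1 h1]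
  have hcover : B = (((B ∩ {k | k 0 < 0}) ∩ {k | k 1 < 0}) ∪ ((B ∩ {k | k 0 < 0}) \ {k | k 1 < 0})) ∪
      (((B \ {k | k 0 < 0}) ∩ {k | k 1 < 0}) ∪ ((B \ {k | k 0 < 0}) \ {k | k 1 < 0})) := by
    rw [inter_union_sdiff, inter_union_sdiff, inter_union_sdiff]
  calc μH[1] (klphShift '' B)
      = μH[1] ((klphShift '' ((B ∩ {k | k 0 < 0}) ∩ {k | k 1 < 0}) ∪ klphShift '' ((B ∩ {k | k 0 < 0}) \ {k | k 1 < 0})) ∪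
          (klphShift '' ((B \ {k | k 0 < 0}) ∩ {k | k 1 < 0}) ∪ klphShift '' ((B \ {k | k 0 < 0}) \ {k | k 1 < 0}))) := by
        conv_lhs => rw [hcover]
        rw [image_union, image_union, image_union]
    _ ≤ (μH[1] (klphShift '' ((B ∩ {k | k 0 < 0}) ∩ {k | k 1 < 0})) + μH[1] (klphShift '' ((B ∩ {k | k 0 < 0}) \ {k | k 1 < 0}))) +
          (μH[1] (klphShift '' ((B \ {k | k 0 < 0}) ∩ {k | k 1 < 0})) + μH[1] (klphShift '' ((B \ {k | k 0 < 0}) \ {k | k 1 < 0}))) :=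
        (measure_union_le _ _).trans (add_le_add (measure_union_le _ _) (measure_union_le _ _))
    _ = (μH[1] ((B ∩ {k | k 0 < 0}) ∩ {k | k 1 < 0}) + μH[1] ((B ∩ {k | k 0 < 0}) \ {k | k 1 < 0})) +
          (μH[1] ((B \ {k | k 0 < 0}) ∩ {k | k 1 < 0}) + μH[1] ((B \ {k | k 0 < 0}) \ {k | k 1 < 0})) := by
        rw [h1.image_eq, h2.image_eq, h3.image_eq, h4.image_eq, klph_hausdorffMeasure_image_add_right,
          klph_hausdorffMeasure_image_add_right, klph_hausdorffMeasure_image_add_right, klph_hausdorffMeasure_image_add_right]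
    _ = μH[1] B := by
        rw [measure_inter_add_sdiff _ hH1, measure_inter_add_sdiff _ hH1, measure_inter_add_sdiff _ hH0]

/-- **The shift preserves arc length of subsets of the zone**: `μH[1] (T '' B) = μH[1] B` for `B ⊆ BZ`.
[folklore] -/
theorem klph_hausdorffMeasure_image_shift {B : Set Momentum} (hB : B ⊆ brillouinZone) :
    μH[1] (klphShift '' B) = μH[1] B := by
  refine le_antisymm (klph_hausdorffMeasure_image_shift_le hB) ?_
  have hB' : klphShift '' B ⊆ brillouinZone := by
    rintro _ ⟨k, hk, rfl⟩
    exact (klphShift_mem_brillouinZone_iff k).2 (hB hk)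
  have h := klph_hausdorffMeasure_image_shift_le hB'
  rwa [klphShift_involutive.leftInverse.image_image] at h

/-- Preimages under the involution `T` are images. [folklore] -/
theorem klphShift_preimage_eq_image (s : Set Momentum) : klphShift ⁻¹' s = klphShift '' s :=
  (Set.image_eq_preimage_of_inverse klphShift_involutive.leftInverse klphShift_involutive.rightInverse
    ▸ rfl : klphShift '' s = klphShift ⁻¹' s).symm

/-- **Arc length on the reflected Fermi curve is pushed forward to arc length on the Fermi curve**:
`T` is measure preserving from `μH[1]⌊F(ε_{-t′}, -μ)` to `μH[1]⌊F(ε_{t′}, μ)`. [folklore] -/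
theorem klph_measurePreserving_shift_hausdorff (tp μ : ℝ) :
    MeasurePreserving klphShift
      ((μH[1] : Measure Momentum).restrict (fermiCurve (squareDispersion 1 (-tp)) (-μ)))
      ((μH[1] : Measure Momentum).restrict (fermiCurve (squareDispersion 1 tp) μ)) := by
  refine ⟨klph_measurable_shift, Measure.ext fun A hA => ?_⟩
  rw [Measure.map_apply klph_measurable_shift hA, Measure.restrict_apply (klph_measurable_shift hA),
    Measure.restrict_apply hA, ← klphShift_preimage_fermiCurve tp μ, ← preimage_inter,
    klphShift_preimage_eq_image]
  exact klph_hausdorffMeasure_image_shift (fun k hk => hk.2.1)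

/-- A measure-preserving measurable equivalence pushes a pulled-back density forward:
`e_* (ν · (g ∘ e)) = ν' · g`. [folklore] -/
theorem klph_map_withDensity_comp_equiv {α β : Type*} [MeasurableSpace α] [MeasurableSpace β]
    {ν : Measure α} {ν' : Measure β} (e : α ≃ᵐ β) (h : MeasurePreserving e ν ν') (g : β → ℝ≥0∞) :
    Measure.map e (ν.withDensity (g ∘ e)) = ν'.withDensity g := by
  ext s hs
  rw [e.map_apply, withDensity_apply _ (e.measurable hs), withDensity_apply _ hs,
    ← h.setLIntegral_comp_preimage_emb e.measurableEmbedding g s]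
  rfl

/-- **The shift pushes the Fermi-curve (density-of-states) measure of `(-t′, -μ)` forward to that of
`(t′, μ)`**: `T_* σ[ε_{-t′}, -μ] = σ[ε_{t′}, μ]`. [cite: RaghuKivelsonScalapino2010, §II (6) and (8)] -/
theorem klph_measurePreserving_shift_fermiCurveMeasure (tp μ : ℝ) :
    MeasurePreserving klphShift (fermiCurveMeasure (squareDispersion 1 (-tp)) (-μ))
      (fermiCurveMeasure (squareDispersion 1 tp) μ) := by
  refine ⟨klph_measurable_shift, ?_⟩
  have hmp := klph_measurePreserving_shift_hausdorff tp μ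
  set ν := (μH[1] : Measure Momentum).restrict (fermiCurve (squareDispersion 1 (-tp)) (-μ)) with hν
  have hF := measurableSet_fermiCurve (measurable_squareDispersion 1 (-tp)) (-μ)
  -- on the reflected curve the density of `(-t′, -μ)` is the pulled-back density of `(t′, μ)`
  have hae : (fun k => ENNReal.ofReal (‖gradient (squareDispersion 1 (-tp)) k‖⁻¹)) =ᵐ[ν]
      (fun k => ENNReal.ofReal (‖gradient (squareDispersion 1 tp) k‖⁻¹)) ∘ klphShift := by
    filter_upwards [ae_restrict_mem hF] with k hk
    exact (klph_density_klphShift tp hk.1).symm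
  unfold fermiCurveMeasure
  rw [← hν, withDensity_congr_ae hae]
  exact klph_map_withDensity_comp_equiv klphShiftEquiv hmp _

end Summit.HubbardSuperconductivity.HubbardSuperconductivity.Theorems

end
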